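/-
Copyright (c) 2026. All rights reserved.
Released under Apache 2.0 license as described in the file LICENSE.
-/
import Summits.AtomisticToContinuum.Crystallization.Theorems.OverbindingBudgetAffineFarStraighteningCompatCert

/-!
# Overbinding budget — R_aff′ brick EXT, integer certificate: a two-point isometric snap extends or misses by `≥ 1/3`

Slot Z of `stmt-AtomisticToContinuum-31280`, leaf `…FarSmoothSplit.AffineChartStraightening'` (R_aff′), radial development (g59
memo §3).  This file is the kernel-decided half of brick EXT (`…StraighteningExt.snapExtension_holds`): for every label `f`, EVERY
independent adjacent pair `c₁, c₂` of the common shell of `f` (`2 c₁·c₂ = N'` or `c₁·c₂ = 0`), every Gram-matched image pair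
`d₁, d₂` adjacent to `e`, every further common neighbour `c'` of `f` and every common neighbour `p` of `e`: the integer image
`q = 8N' e + B₁(2d₁ − e) + B₂(2d₂ − e)` (`= 16N'(U c' + e)`) either equals `16N' p` or `‖q − 16N' p‖² ≥ 256 N'² N / 9` (real distance
`≥ 1/3`); and the planar decomposition `16N' c' = 8N' f + B₁(2c₁ − f) + B₂(2c₂ − f)` holds coordinatewise.  Exact enumeration
`g59/compat/ext_cert2.py`: 2304 two-point snaps, 8208 coincidences, 0 violations, minimal nonzero squared distance `2/9`.
One `decide +kernel` per label (48) — the elaborator's `Decidable` synthesis does not scale to the all-labels statement.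
-/

namespace Summit.AtomisticToContinuum.Crystallization.Theorems.OverbindingBudgetAffineFarSmoothSplit

open Literature.Geometry.DiscreteGeometry (sqNormInt fccInt hcpInt)

/-! ## §1  Definitions -/

/-- `B₁ = 3(4 c'·c₁ − N') − σ (4 c'·c₂ − N')` (`8N'` times the `c₁ − f/2`-coordinate of `c' − f/2`); `B₂` is `extB N' c₂ c₁ c'`.
[this file] -/
def extB (N' : ℤ) (c₁ c₂ c' : Fin 3 → ℤ) : ℤ :=
  3 * (4 * dotInt c' c₁ - N') - snapSigma N' c₁ c₂ * (4 * dotInt c' c₂ - N')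

/-- The planar decomposition `16N' c' = 8N' f + B₁ (2c₁ − f) + B₂ (2c₂ − f)`, coordinatewise. [this file] -/
def ExtDecompOK (N' : ℤ) (f c₁ c₂ c' : Fin 3 → ℤ) : Prop :=
  ∀ i : Fin 3, 16 * N' * c' i = 8 * N' * f i + extB N' c₁ c₂ c' * (2 * c₁ i - f i) + extB N' c₂ c₁ c' * (2 * c₂ i - f i)

/-- The image `q = 8N' e + B₁ (2d₁ − e) + B₂ (2d₂ − e)` (`= 16N'(U c' + e)` in the real model). [this file] -/
def extQ (N' : ℤ) (e d₁ d₂ c₁ c₂ c' : Fin 3 → ℤ) : Fin 3 → ℤ := fun i =>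
  8 * N' * e i + extB N' c₁ c₂ c' * (2 * d₁ i - e i) + extB N' c₂ c₁ c' * (2 * d₂ i - e i)

/-- The pair test: `q = 16N' p` or `‖q − 16N' p‖² ≥ 256 N'² N / 9` (distance `≥ 1/3`). [this file] -/
def ExtPairOK (N N' : ℤ) (e d₁ d₂ c₁ c₂ c' p : Fin 3 → ℤ) : Prop :=
  (∀ i : Fin 3, extQ N' e d₁ d₂ c₁ c₂ c' i = 16 * N' * p i) ∨
    256 * N' ^ 2 * N ≤ 9 * sqNormInt fun i => extQ N' e d₁ d₂ c₁ c₂ c' i - 16 * N' * p i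

/-- The members of `S` adjacent to `e` (squared integer distance `N`): the common-shell candidates. [this file] -/
def adjInt (S : Finset (Fin 3 → ℤ)) (N : ℤ) (e : Fin 3 → ℤ) : Finset (Fin 3 → ℤ) := S.filter fun d => sqNormInt (d - e) = N

/-- Certificate core for a label `f` and an independent adjacent pair `c₁, c₂` (bounded quantifiers over `adjInt` keep the
`Decidable` synthesis shallow and the kernel evaluation fast). [this file] -/
def SnapExtCore (S : Finset (Fin 3 → ℤ)) (N : ℤ) (S' : Finset (Fin 3 → ℤ)) (N' : ℤ) (f c₁ c₂ : Fin 3 → ℤ) : Prop :=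
  (∀ c' ∈ adjInt S' N' f, ExtDecompOK N' f c₁ c₂ c') ∧
    ∀ e ∈ S, ∀ d₁ ∈ adjInt S N e, ∀ d₂ ∈ adjInt S N e, N' * dotInt d₁ d₂ = N * dotInt c₁ c₂ →
      ∀ c' ∈ adjInt S' N' f, ∀ p ∈ adjInt S N e, ExtPairOK N N' e d₁ d₂ c₁ c₂ c' p

/-- Certificate at a label `f`: EVERY independent adjacent pair passes the core. [this file] -/
def SnapExtAt (S : Finset (Fin 3 → ℤ)) (N : ℤ) (S' : Finset (Fin 3 → ℤ)) (N' : ℤ) (f : Fin 3 → ℤ) : Prop :=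
  ∀ c₁ ∈ adjInt S' N' f, ∀ c₂ ∈ adjInt S' N' f, (2 * dotInt c₁ c₂ = N' ∨ dotInt c₁ c₂ = 0) → SnapExtCore S N S' N' f c₁ c₂

/-! ## §2  The 48 certificates (PROVED, kernel `decide`) -/

/-- EXT certificate `fcc ← fcc`, label `f = ![1, 1, 0]`. [this file] -/
theorem snapExtAt_fcc_fcc_0 : SnapExtAt fccInt 2 fccInt 2 ![1, 1, 0] := by
  unfold SnapExtAt SnapExtCore adjInt ExtDecompOK ExtPairOK extQ extB snapSigma dotInt
  decide +kernel

/-- EXT certificate `fcc ← fcc`, label `f = ![1, -1, 0]`. [this file] -/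
theorem snapExtAt_fcc_fcc_1 : SnapExtAt fccInt 2 fccInt 2 ![1, -1, 0] := by
  unfold SnapExtAt SnapExtCore adjInt ExtDecompOK ExtPairOK extQ extB snapSigma dotInt
  decide +kernel

/-- EXT certificate `fcc ← fcc`, label `f = ![-1, 1, 0]`. [this file] -/
theorem snapExtAt_fcc_fcc_2 : SnapExtAt fccInt 2 fccInt 2 ![-1, 1, 0] := by
  unfold SnapExtAt SnapExtCore adjInt ExtDecompOK ExtPairOK extQ extB snapSigma dotInt
  decide +kernel

/-- EXT certificate `fcc ← fcc`, label `f = ![-1, -1, 0]`. [this file] -/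
theorem snapExtAt_fcc_fcc_3 : SnapExtAt fccInt 2 fccInt 2 ![-1, -1, 0] := by
  unfold SnapExtAt SnapExtCore adjInt ExtDecompOK ExtPairOK extQ extB snapSigma dotInt
  decide +kernel

/-- EXT certificate `fcc ← fcc`, label `f = ![1, 0, 1]`. [this file] -/
theorem snapExtAt_fcc_fcc_4 : SnapExtAt fccInt 2 fccInt 2 ![1, 0, 1] := by
  unfold SnapExtAt SnapExtCore adjInt ExtDecompOK ExtPairOK extQ extB snapSigma dotInt
  decide +kernel

/-- EXT certificate `fcc ← fcc`, label `f = ![1, 0, -1]`. [this file] -/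
theorem snapExtAt_fcc_fcc_5 : SnapExtAt fccInt 2 fccInt 2 ![1, 0, -1] := by
  unfold SnapExtAt SnapExtCore adjInt ExtDecompOK ExtPairOK extQ extB snapSigma dotInt
  decide +kernel

/-- EXT certificate `fcc ← fcc`, label `f = ![-1, 0, 1]`. [this file] -/
theorem snapExtAt_fcc_fcc_6 : SnapExtAt fccInt 2 fccInt 2 ![-1, 0, 1] := by
  unfold SnapExtAt SnapExtCore adjInt ExtDecompOK ExtPairOK extQ extB snapSigma dotInt
  decide +kernel

/-- EXT certificate `fcc ← fcc`, label `f = ![-1, 0, -1]`. [this file] -/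
theorem snapExtAt_fcc_fcc_7 : SnapExtAt fccInt 2 fccInt 2 ![-1, 0, -1] := by
  unfold SnapExtAt SnapExtCore adjInt ExtDecompOK ExtPairOK extQ extB snapSigma dotInt
  decide +kernel

/-- EXT certificate `fcc ← fcc`, label `f = ![0, 1, 1]`. [this file] -/
theorem snapExtAt_fcc_fcc_8 : SnapExtAt fccInt 2 fccInt 2 ![0, 1, 1] := by
  unfold SnapExtAt SnapExtCore adjInt ExtDecompOK ExtPairOK extQ extB snapSigma dotInt
  decide +kernel

/-- EXT certificate `fcc ← fcc`, label `f = ![0, 1, -1]`. [this file] -/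
theorem snapExtAt_fcc_fcc_9 : SnapExtAt fccInt 2 fccInt 2 ![0, 1, -1] := by
  unfold SnapExtAt SnapExtCore adjInt ExtDecompOK ExtPairOK extQ extB snapSigma dotInt
  decide +kernel

/-- EXT certificate `fcc ← fcc`, label `f = ![0, -1, 1]`. [this file] -/
theorem snapExtAt_fcc_fcc_10 : SnapExtAt fccInt 2 fccInt 2 ![0, -1, 1] := by
  unfold SnapExtAt SnapExtCore adjInt ExtDecompOK ExtPairOK extQ extB snapSigma dotInt
  decide +kernel

/-- EXT certificate `fcc ← fcc`, label `f = ![0, -1, -1]`. [this file] -/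
theorem snapExtAt_fcc_fcc_11 : SnapExtAt fccInt 2 fccInt 2 ![0, -1, -1] := by
  unfold SnapExtAt SnapExtCore adjInt ExtDecompOK ExtPairOK extQ extB snapSigma dotInt
  decide +kernel

/-- EXT certificate `fcc ← fcc` (all labels). [this file] -/
theorem snapExtAt_fcc_fcc : ∀ f ∈ fccInt, SnapExtAt fccInt 2 fccInt 2 f := by
  intro f hf
  simp only [fccInt, Finset.mem_insert, Finset.mem_singleton] at hf
  rcases hf with rfl | rfl | rfl | rfl | rfl | rfl | rfl | rfl | rfl | rfl | rfl | rfl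
  exacts [snapExtAt_fcc_fcc_0, snapExtAt_fcc_fcc_1, snapExtAt_fcc_fcc_2, snapExtAt_fcc_fcc_3,
    snapExtAt_fcc_fcc_4, snapExtAt_fcc_fcc_5, snapExtAt_fcc_fcc_6, snapExtAt_fcc_fcc_7,
    snapExtAt_fcc_fcc_8, snapExtAt_fcc_fcc_9, snapExtAt_fcc_fcc_10, snapExtAt_fcc_fcc_11]

/-- EXT certificate `fcc ← hcp`, label `f = ![3, -3, 0]`. [this file] -/
theorem snapExtAt_fcc_hcp_0 : SnapExtAt fccInt 2 hcpInt 18 ![3, -3, 0] := by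
  unfold SnapExtAt SnapExtCore adjInt ExtDecompOK ExtPairOK extQ extB snapSigma dotInt
  decide +kernel

/-- EXT certificate `fcc ← hcp`, label `f = ![-3, 3, 0]`. [this file] -/
theorem snapExtAt_fcc_hcp_1 : SnapExtAt fccInt 2 hcpInt 18 ![-3, 3, 0] := by
  unfold SnapExtAt SnapExtCore adjInt ExtDecompOK ExtPairOK extQ extB snapSigma dotInt
  decide +kernel

/-- EXT certificate `fcc ← hcp`, label `f = ![3, 0, -3]`. [this file] -/
theorem snapExtAt_fcc_hcp_2 : SnapExtAt fccInt 2 hcpInt 18 ![3, 0, -3] := by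
  unfold SnapExtAt SnapExtCore adjInt ExtDecompOK ExtPairOK extQ extB snapSigma dotInt
  decide +kernel

/-- EXT certificate `fcc ← hcp`, label `f = ![-3, 0, 3]`. [this file] -/
theorem snapExtAt_fcc_hcp_3 : SnapExtAt fccInt 2 hcpInt 18 ![-3, 0, 3] := by
  unfold SnapExtAt SnapExtCore adjInt ExtDecompOK ExtPairOK extQ extB snapSigma dotInt
  decide +kernel

/-- EXT certificate `fcc ← hcp`, label `f = ![0, 3, -3]`. [this file] -/
theorem snapExtAt_fcc_hcp_4 : SnapExtAt fccInt 2 hcpInt 18 ![0, 3, -3] := by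
  unfold SnapExtAt SnapExtCore adjInt ExtDecompOK ExtPairOK extQ extB snapSigma dotInt
  decide +kernel

/-- EXT certificate `fcc ← hcp`, label `f = ![0, -3, 3]`. [this file] -/
theorem snapExtAt_fcc_hcp_5 : SnapExtAt fccInt 2 hcpInt 18 ![0, -3, 3] := by
  unfold SnapExtAt SnapExtCore adjInt ExtDecompOK ExtPairOK extQ extB snapSigma dotInt
  decide +kernel

/-- EXT certificate `fcc ← hcp`, label `f = ![3, 3, 0]`. [this file] -/
theorem snapExtAt_fcc_hcp_6 : SnapExtAt fccInt 2 hcpInt 18 ![3, 3, 0] := by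
  unfold SnapExtAt SnapExtCore adjInt ExtDecompOK ExtPairOK extQ extB snapSigma dotInt
  decide +kernel

/-- EXT certificate `fcc ← hcp`, label `f = ![3, 0, 3]`. [this file] -/
theorem snapExtAt_fcc_hcp_7 : SnapExtAt fccInt 2 hcpInt 18 ![3, 0, 3] := by
  unfold SnapExtAt SnapExtCore adjInt ExtDecompOK ExtPairOK extQ extB snapSigma dotInt
  decide +kernel

/-- EXT certificate `fcc ← hcp`, label `f = ![0, 3, 3]`. [this file] -/
theorem snapExtAt_fcc_hcp_8 : SnapExtAt fccInt 2 hcpInt 18 ![0, 3, 3] := by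
  unfold SnapExtAt SnapExtCore adjInt ExtDecompOK ExtPairOK extQ extB snapSigma dotInt
  decide +kernel

/-- EXT certificate `fcc ← hcp`, label `f = ![-1, -1, -4]`. [this file] -/
theorem snapExtAt_fcc_hcp_9 : SnapExtAt fccInt 2 hcpInt 18 ![-1, -1, -4] := by
  unfold SnapExtAt SnapExtCore adjInt ExtDecompOK ExtPairOK extQ extB snapSigma dotInt
  decide +kernel

/-- EXT certificate `fcc ← hcp`, label `f = ![-1, -4, -1]`. [this file] -/
theorem snapExtAt_fcc_hcp_10 : SnapExtAt fccInt 2 hcpInt 18 ![-1, -4, -1] := by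
  unfold SnapExtAt SnapExtCore adjInt ExtDecompOK ExtPairOK extQ extB snapSigma dotInt
  decide +kernel

/-- EXT certificate `fcc ← hcp`, label `f = ![-4, -1, -1]`. [this file] -/
theorem snapExtAt_fcc_hcp_11 : SnapExtAt fccInt 2 hcpInt 18 ![-4, -1, -1] := by
  unfold SnapExtAt SnapExtCore adjInt ExtDecompOK ExtPairOK extQ extB snapSigma dotInt
  decide +kernel

/-- EXT certificate `fcc ← hcp` (all labels). [this file] -/
theorem snapExtAt_fcc_hcp : ∀ f ∈ hcpInt, SnapExtAt fccInt 2 hcpInt 18 f := by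
  intro f hf
  simp only [hcpInt, Finset.mem_insert, Finset.mem_singleton] at hf
  rcases hf with rfl | rfl | rfl | rfl | rfl | rfl | rfl | rfl | rfl | rfl | rfl | rfl
  exacts [snapExtAt_fcc_hcp_0, snapExtAt_fcc_hcp_1, snapExtAt_fcc_hcp_2, snapExtAt_fcc_hcp_3,
    snapExtAt_fcc_hcp_4, snapExtAt_fcc_hcp_5, snapExtAt_fcc_hcp_6, snapExtAt_fcc_hcp_7,
    snapExtAt_fcc_hcp_8, snapExtAt_fcc_hcp_9, snapExtAt_fcc_hcp_10, snapExtAt_fcc_hcp_11]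

/-- EXT certificate `hcp ← fcc`, label `f = ![1, 1, 0]`. [this file] -/
theorem snapExtAt_hcp_fcc_0 : SnapExtAt hcpInt 18 fccInt 2 ![1, 1, 0] := by
  unfold SnapExtAt SnapExtCore adjInt ExtDecompOK ExtPairOK extQ extB snapSigma dotInt
  decide +kernel

/-- EXT certificate `hcp ← fcc`, label `f = ![1, -1, 0]`. [this file] -/
theorem snapExtAt_hcp_fcc_1 : SnapExtAt hcpInt 18 fccInt 2 ![1, -1, 0] := by
  unfold SnapExtAt SnapExtCore adjInt ExtDecompOK ExtPairOK extQ extB snapSigma dotInt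
  decide +kernel

/-- EXT certificate `hcp ← fcc`, label `f = ![-1, 1, 0]`. [this file] -/
theorem snapExtAt_hcp_fcc_2 : SnapExtAt hcpInt 18 fccInt 2 ![-1, 1, 0] := by
  unfold SnapExtAt SnapExtCore adjInt ExtDecompOK ExtPairOK extQ extB snapSigma dotInt
  decide +kernel

/-- EXT certificate `hcp ← fcc`, label `f = ![-1, -1, 0]`. [this file] -/
theorem snapExtAt_hcp_fcc_3 : SnapExtAt hcpInt 18 fccInt 2 ![-1, -1, 0] := by
  unfold SnapExtAt SnapExtCore adjInt ExtDecompOK ExtPairOK extQ extB snapSigma dotInt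
  decide +kernel

/-- EXT certificate `hcp ← fcc`, label `f = ![1, 0, 1]`. [this file] -/
theorem snapExtAt_hcp_fcc_4 : SnapExtAt hcpInt 18 fccInt 2 ![1, 0, 1] := by
  unfold SnapExtAt SnapExtCore adjInt ExtDecompOK ExtPairOK extQ extB snapSigma dotInt
  decide +kernel

/-- EXT certificate `hcp ← fcc`, label `f = ![1, 0, -1]`. [this file] -/
theorem snapExtAt_hcp_fcc_5 : SnapExtAt hcpInt 18 fccInt 2 ![1, 0, -1] := by
  unfold SnapExtAt SnapExtCore adjInt ExtDecompOK ExtPairOK extQ extB snapSigma dotInt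
  decide +kernel

/-- EXT certificate `hcp ← fcc`, label `f = ![-1, 0, 1]`. [this file] -/
theorem snapExtAt_hcp_fcc_6 : SnapExtAt hcpInt 18 fccInt 2 ![-1, 0, 1] := by
  unfold SnapExtAt SnapExtCore adjInt ExtDecompOK ExtPairOK extQ extB snapSigma dotInt
  decide +kernel

/-- EXT certificate `hcp ← fcc`, label `f = ![-1, 0, -1]`. [this file] -/
theorem snapExtAt_hcp_fcc_7 : SnapExtAt hcpInt 18 fccInt 2 ![-1, 0, -1] := by
  unfold SnapExtAt SnapExtCore adjInt ExtDecompOK ExtPairOK extQ extB snapSigma dotInt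
  decide +kernel

/-- EXT certificate `hcp ← fcc`, label `f = ![0, 1, 1]`. [this file] -/
theorem snapExtAt_hcp_fcc_8 : SnapExtAt hcpInt 18 fccInt 2 ![0, 1, 1] := by
  unfold SnapExtAt SnapExtCore adjInt ExtDecompOK ExtPairOK extQ extB snapSigma dotInt
  decide +kernel

/-- EXT certificate `hcp ← fcc`, label `f = ![0, 1, -1]`. [this file] -/
theorem snapExtAt_hcp_fcc_9 : SnapExtAt hcpInt 18 fccInt 2 ![0, 1, -1] := by
  unfold SnapExtAt SnapExtCore adjInt ExtDecompOK ExtPairOK extQ extB snapSigma dotInt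
  decide +kernel

/-- EXT certificate `hcp ← fcc`, label `f = ![0, -1, 1]`. [this file] -/
theorem snapExtAt_hcp_fcc_10 : SnapExtAt hcpInt 18 fccInt 2 ![0, -1, 1] := by
  unfold SnapExtAt SnapExtCore adjInt ExtDecompOK ExtPairOK extQ extB snapSigma dotInt
  decide +kernel

/-- EXT certificate `hcp ← fcc`, label `f = ![0, -1, -1]`. [this file] -/
theorem snapExtAt_hcp_fcc_11 : SnapExtAt hcpInt 18 fccInt 2 ![0, -1, -1] := by
  unfold SnapExtAt SnapExtCore adjInt ExtDecompOK ExtPairOK extQ extB snapSigma dotInt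
  decide +kernel

/-- EXT certificate `hcp ← fcc` (all labels). [this file] -/
theorem snapExtAt_hcp_fcc : ∀ f ∈ fccInt, SnapExtAt hcpInt 18 fccInt 2 f := by
  intro f hf
  simp only [fccInt, Finset.mem_insert, Finset.mem_singleton] at hf
  rcases hf with rfl | rfl | rfl | rfl | rfl | rfl | rfl | rfl | rfl | rfl | rfl | rfl
  exacts [snapExtAt_hcp_fcc_0, snapExtAt_hcp_fcc_1, snapExtAt_hcp_fcc_2, snapExtAt_hcp_fcc_3,
    snapExtAt_hcp_fcc_4, snapExtAt_hcp_fcc_5, snapExtAt_hcp_fcc_6, snapExtAt_hcp_fcc_7,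
    snapExtAt_hcp_fcc_8, snapExtAt_hcp_fcc_9, snapExtAt_hcp_fcc_10, snapExtAt_hcp_fcc_11]

/-- EXT certificate `hcp ← hcp`, label `f = ![3, -3, 0]`. [this file] -/
theorem snapExtAt_hcp_hcp_0 : SnapExtAt hcpInt 18 hcpInt 18 ![3, -3, 0] := by
  unfold SnapExtAt SnapExtCore adjInt ExtDecompOK ExtPairOK extQ extB snapSigma dotInt
  decide +kernel

/-- EXT certificate `hcp ← hcp`, label `f = ![-3, 3, 0]`. [this file] -/
theorem snapExtAt_hcp_hcp_1 : SnapExtAt hcpInt 18 hcpInt 18 ![-3, 3, 0] := by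
  unfold SnapExtAt SnapExtCore adjInt ExtDecompOK ExtPairOK extQ extB snapSigma dotInt
  decide +kernel

/-- EXT certificate `hcp ← hcp`, label `f = ![3, 0, -3]`. [this file] -/
theorem snapExtAt_hcp_hcp_2 : SnapExtAt hcpInt 18 hcpInt 18 ![3, 0, -3] := by
  unfold SnapExtAt SnapExtCore adjInt ExtDecompOK ExtPairOK extQ extB snapSigma dotInt
  decide +kernel

/-- EXT certificate `hcp ← hcp`, label `f = ![-3, 0, 3]`. [this file] -/
theorem snapExtAt_hcp_hcp_3 : SnapExtAt hcpInt 18 hcpInt 18 ![-3, 0, 3] := by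
  unfold SnapExtAt SnapExtCore adjInt ExtDecompOK ExtPairOK extQ extB snapSigma dotInt
  decide +kernel

/-- EXT certificate `hcp ← hcp`, label `f = ![0, 3, -3]`. [this file] -/
theorem snapExtAt_hcp_hcp_4 : SnapExtAt hcpInt 18 hcpInt 18 ![0, 3, -3] := by
  unfold SnapExtAt SnapExtCore adjInt ExtDecompOK ExtPairOK extQ extB snapSigma dotInt
  decide +kernel

/-- EXT certificate `hcp ← hcp`, label `f = ![0, -3, 3]`. [this file] -/
theorem snapExtAt_hcp_hcp_5 : SnapExtAt hcpInt 18 hcpInt 18 ![0, -3, 3] := by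
  unfold SnapExtAt SnapExtCore adjInt ExtDecompOK ExtPairOK extQ extB snapSigma dotInt
  decide +kernel

/-- EXT certificate `hcp ← hcp`, label `f = ![3, 3, 0]`. [this file] -/
theorem snapExtAt_hcp_hcp_6 : SnapExtAt hcpInt 18 hcpInt 18 ![3, 3, 0] := by
  unfold SnapExtAt SnapExtCore adjInt ExtDecompOK ExtPairOK extQ extB snapSigma dotInt
  decide +kernel

/-- EXT certificate `hcp ← hcp`, label `f = ![3, 0, 3]`. [this file] -/
theorem snapExtAt_hcp_hcp_7 : SnapExtAt hcpInt 18 hcpInt 18 ![3, 0, 3] := by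
  unfold SnapExtAt SnapExtCore adjInt ExtDecompOK ExtPairOK extQ extB snapSigma dotInt
  decide +kernel

/-- EXT certificate `hcp ← hcp`, label `f = ![0, 3, 3]`. [this file] -/
theorem snapExtAt_hcp_hcp_8 : SnapExtAt hcpInt 18 hcpInt 18 ![0, 3, 3] := by
  unfold SnapExtAt SnapExtCore adjInt ExtDecompOK ExtPairOK extQ extB snapSigma dotInt
  decide +kernel

/-- EXT certificate `hcp ← hcp`, label `f = ![-1, -1, -4]`. [this file] -/
theorem snapExtAt_hcp_hcp_9 : SnapExtAt hcpInt 18 hcpInt 18 ![-1, -1, -4] := by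
  unfold SnapExtAt SnapExtCore adjInt ExtDecompOK ExtPairOK extQ extB snapSigma dotInt
  decide +kernel

/-- EXT certificate `hcp ← hcp`, label `f = ![-1, -4, -1]`. [this file] -/
theorem snapExtAt_hcp_hcp_10 : SnapExtAt hcpInt 18 hcpInt 18 ![-1, -4, -1] := by
  unfold SnapExtAt SnapExtCore adjInt ExtDecompOK ExtPairOK extQ extB snapSigma dotInt
  decide +kernel

/-- EXT certificate `hcp ← hcp`, label `f = ![-4, -1, -1]`. [this file] -/
theorem snapExtAt_hcp_hcp_11 : SnapExtAt hcpInt 18 hcpInt 18 ![-4, -1, -1] := by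
  unfold SnapExtAt SnapExtCore adjInt ExtDecompOK ExtPairOK extQ extB snapSigma dotInt
  decide +kernel

/-- EXT certificate `hcp ← hcp` (all labels). [this file] -/
theorem snapExtAt_hcp_hcp : ∀ f ∈ hcpInt, SnapExtAt hcpInt 18 hcpInt 18 f := by
  intro f hf
  simp only [hcpInt, Finset.mem_insert, Finset.mem_singleton] at hf
  rcases hf with rfl | rfl | rfl | rfl | rfl | rfl | rfl | rfl | rfl | rfl | rfl | rfl
  exacts [snapExtAt_hcp_hcp_0, snapExtAt_hcp_hcp_1, snapExtAt_hcp_hcp_2, snapExtAt_hcp_hcp_3,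
    snapExtAt_hcp_hcp_4, snapExtAt_hcp_hcp_5, snapExtAt_hcp_hcp_6, snapExtAt_hcp_hcp_7,
    snapExtAt_hcp_hcp_8, snapExtAt_hcp_hcp_9, snapExtAt_hcp_hcp_10, snapExtAt_hcp_hcp_11]

end Summit.AtomisticToContinuum.Crystallization.Theorems.OverbindingBudgetAffineFarSmoothSplit
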